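import Mathlib
import Summits.PneNP.PneNP.Theorems.Sd2BlProp7Legs
import Summits.PneNP.PneNP.Theorems.Sd2BlNumerics

/-!
# The parametric remainder package of the sign-degree-2 engine — line «sfm-bl» made parametric
# (cell pnp-ideate, ROUND-18 item K1'' `SignDeg2Signing.SignDeg2SigningFP`, stage S2)

FRONTIER (range avoidance for sign-degree-≤2 local maps at linear stretch; restricted-model algorithmic
rung); nothing here bears on P vs NP.

Twin of `SfmBl.remainder_package_param` with `ℓ` legs per output and SYMBOLIC constants (`Sd2BlNumerics`):
degree cap `L = 4^t`, Hoeffding scale `γ′ = √(102·L·s)` (`s = 2t`), remainder sparseness threshold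
`γ_R = 4ℓ·√(34ℓLs)` on connected pairs of total size `≤ t₀`, integer RADIUS `R = 2400·ℓ²·s·(s+1)·2^t`,
stretch `48·R·n ≤ m`, under the size condition `(T1) 28800·ℓ³·s·(s+1) ≤ 2^t`.  Conclusions:
`A₁ := 10(N·R^{2k} + 1) ≤ (√2·R)^{2k}` (when `20N ≤ 2^k`), `Σ_T tr(A_T^{2k}) ≤ 2^m·A₁/10` (when `N ≤ 2^b`,
`4k + 2b ≤ 10(t₀+1)`), and the remainder budget `N·√2R/2 ≤ m/4` (when `N ≤ 8n + 2ℓm/L`).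
Ingredients: `Sd2Bl.sum_trace_pow_le_legs_ell` (Prop. 7 for `ℓ` legs, by scaling) and the numerics.
-/

set_option linter.dupNamespace false -- `Summit.PneNP.PneNP.…`: summit = sub-problem name (D-0017 single-conjunct layout)

namespace Summit.PneNP.PneNP.Theorems.Sd2Bl

open Matrix Finset BigOperators
open Summit.PneNP.PneNP.Theorems.CandCutNorm Summit.PneNP.PneNP.Theorems.SfmBl

/-- **REMAINDER PACKAGE, `ℓ` legs per output, symbolic constants** (see the module docstring). -/
theorem remainder_package_ell {α β E : Type} [Fintype α] [Fintype β] [DecidableEq α] [DecidableEq β]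
    [Fintype E] {m n : ℕ} (src : E → α) (dst : E → β) (out : E → Fin m)
    {ℓ : ℕ} (hℓ : 3 ≤ ℓ) (hout : ∀ j : Fin m, (Finset.univ.filter fun e => out e = j).card ≤ ℓ)
    (t : ℕ) (ht : 1 ≤ t) (hT1 : 28800 * ℓ ^ 3 * (2 * t) * (2 * t + 1) ≤ 2 ^ t)
    (hdeg₁ : ∀ i, (Finset.univ.filter fun e => src e = i).card ≤ 2 ^ (2 * t))
    (hdeg₂ : ∀ k, (Finset.univ.filter fun e => dst e = k).card ≤ 2 ^ (2 * t))
    (G : SimpleGraph (α ⊕ β)) [DecidableRel G.Adj] (hG : ∀ e, G.Adj (Sum.inl (src e)) (Sum.inr (dst e)))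
    (hGdeg : ∀ x, G.degree x ≤ 2 ^ (2 * t))
    (hm : 48 * (2400 * ℓ ^ 2 * (2 * t) * (2 * t + 1) * 2 ^ t) * n ≤ m)
    (hN1 : 1 ≤ Fintype.card α + Fintype.card β)
    (hN : ((Fintype.card α : ℝ) + Fintype.card β) ≤ 8 * n + 2 * ℓ * m / (2 : ℝ) ^ (2 * t))
    (k b t₀ : ℕ) (hb : ((Fintype.card α : ℝ) + Fintype.card β) ≤ 2 ^ b)
    (hkb : 2 * (2 * k) + 2 * b ≤ 10 * (t₀ + 1)) (hk : 20 * ((Fintype.card α : ℝ) + Fintype.card β) ≤ 2 ^ k)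
    (hsparse : ∀ (W₁ : Finset α) (W₂ : Finset β),
      (G.induce {x | Sum.elim (fun i => i ∈ W₁) (fun j => j ∈ W₂) x}).Connected →
      W₁.card + W₂.card ≤ t₀ →
      ((Finset.univ.filter fun e => src e ∈ W₁ ∧ dst e ∈ W₂).card : ℝ)
        ≤ (4 * ℓ * Real.sqrt (34 * ℓ * (2 : ℝ) ^ (2 * t) * (2 * t : ℕ)))
          * Real.sqrt ((W₁.card : ℝ) * (W₂.card : ℝ)))
    (M : (Fin m → Bool) → Matrix α β ℝ)
    (hM : ∀ T i k, M T i k = ∑ e ∈ Finset.univ.filter (fun e => src e = i ∧ dst e = k),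
      ((boolSign (T (out e)) : ℤ) : ℝ)) :
    10 * (((Fintype.card α : ℝ) + Fintype.card β)
          * (2400 * (ℓ : ℝ) ^ 2 * (2 * t : ℕ) * ((2 * t : ℕ) + 1) * (2 : ℝ) ^ t) ^ (2 * k) + 1)
        ≤ (Real.sqrt 2 * (2400 * (ℓ : ℝ) ^ 2 * (2 * t : ℕ) * ((2 * t : ℕ) + 1) * (2 : ℝ) ^ t)) ^ (2 * k) ∧
      (∑ T : Fin m → Bool, ((Matrix.fromBlocks (0 : Matrix α α ℝ) (M T) (M T)ᵀ (0 : Matrix β β ℝ))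
          ^ (2 * k)).trace
        ≤ 2 ^ m * (10 * (((Fintype.card α : ℝ) + Fintype.card β)
            * (2400 * (ℓ : ℝ) ^ 2 * (2 * t : ℕ) * ((2 * t : ℕ) + 1) * (2 : ℝ) ^ t) ^ (2 * k) + 1) / 10)) ∧
      ((Fintype.card α : ℝ) + Fintype.card β)
          * (Real.sqrt 2 * (2400 * (ℓ : ℝ) ^ 2 * (2 * t : ℕ) * ((2 * t : ℕ) + 1) * (2 : ℝ) ^ t)) / 2
        ≤ (m : ℝ) / 4 := by
  classical
  obtain ⟨N, hNdef⟩ : ∃ N : ℕ, N = Fintype.card α + Fintype.card β := ⟨_, rfl⟩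
  have hNreal : (N : ℝ) = (Fintype.card α : ℝ) + Fintype.card β := by rw [hNdef]; push_cast; ring
  obtain ⟨L, hLdef⟩ : ∃ L : ℝ, L = (2 : ℝ) ^ (2 * t) := ⟨_, rfl⟩
  obtain ⟨R, hRdef⟩ : ∃ R : ℝ, R = 2400 * (ℓ : ℝ) ^ 2 * (2 * t : ℕ) * ((2 * t : ℕ) + 1) * (2 : ℝ) ^ t :=
    ⟨_, rfl⟩
  obtain ⟨γR, hγRdef⟩ : ∃ γR : ℝ, γR = 4 * ℓ * Real.sqrt (34 * ℓ * (2 : ℝ) ^ (2 * t) * (2 * t : ℕ)) :=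
    ⟨_, rfl⟩
  have hℓ1 : 1 ≤ ℓ := le_trans (by norm_num) hℓ
  have hL2 : (2 : ℝ) ≤ L := by rw [hLdef]; exact two_le_L ht
  have hL0 : (0 : ℝ) < L := by linarith
  have hL₀ : ((2 ^ (2 * t) : ℕ) : ℝ) ≤ L := by rw [hLdef]; push_cast; exact le_rfl
  have hγ'0 : 0 ≤ Real.sqrt (102 * (2 : ℝ) ^ (2 * t) * (2 * t : ℕ)) := Real.sqrt_nonneg _
  have hγ'L : 144 * L * Real.log L ≤ (Real.sqrt (102 * (2 : ℝ) ^ (2 * t) * (2 * t : ℕ))) ^ 2 := by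
    rw [hLdef]; exact gamma'_sq_ge (2 * t)
  have h4896 := cond4896_of_T1 ℓ t hℓ1 hT1
  have hγR : Real.sqrt (102 * (2 : ℝ) ^ (2 * t) * (2 * t : ℕ)) * ℓ ≤ 3 * γR := by
    rw [hγRdef]; exact gamma'_ell_le ℓ (2 * t) hℓ1
  have hγRL : 3 * γR ≤ ℓ * L := by rw [hγRdef, hLdef]; exact three_gammaR_le ℓ (2 * t) h4896
  have hR0 : 0 ≤ R := by rw [hRdef]; positivity
  have hsparse' : ∀ (W₁ : Finset α) (W₂ : Finset β),
      (G.induce {x | Sum.elim (fun i => i ∈ W₁) (fun j => j ∈ W₂) x}).Connected →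
      W₁.card + W₂.card ≤ t₀ →
      ((Finset.univ.filter fun e => src e ∈ W₁ ∧ dst e ∈ W₂).card : ℝ)
        ≤ γR * Real.sqrt ((W₁.card : ℝ) * (W₂.card : ℝ)) := by
    rw [hγRdef]; exact hsparse
  -- Prop. 7 for `ℓ` legs (scaling)
  have h7 := sum_trace_pow_le_legs_ell src dst out hℓ hout hdeg₁ hdeg₂ hL2 hL₀ G hG hGdeg hL₀ hγ'0 hγ'L
    hγR hγRL t₀ hsparse' M hM k
  -- the radius absorbs `(ℓ/3)·ρ`
  obtain ⟨ρ, hρdef⟩ : ∃ ρ : ℝ, ρ = 100 * ((3 * γR / ℓ) * (Real.logb 2 (L / (3 * γR / ℓ)) + 1)) := ⟨_, rfl⟩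
  rw [← hρdef] at h7
  have hℓpos : (0 : ℝ) < ℓ := by exact_mod_cast (lt_of_lt_of_le (by norm_num) hℓ)
  have hγsp1 : (1 : ℝ) ≤ 3 * γR / ℓ := by
    rw [hγRdef, gammasp_eq ℓ (2 * t) hℓ1]; exact one_le_gammasp ℓ (2 * t) hℓ1 (by omega)
  have hγsp0 : (0 : ℝ) < 3 * γR / ℓ := by linarith
  have hγspL : 3 * γR / ℓ ≤ L := by rw [div_le_iff₀ hℓpos]; linarith
  have hlog0 : 0 ≤ Real.logb 2 (L / (3 * γR / ℓ)) :=
    Real.logb_nonneg (by norm_num) (by rw [le_div_iff₀ hγsp0, one_mul]; exact hγspL)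
  have hρ0 : 0 ≤ ρ := by rw [hρdef]; positivity
  have hℓρ : (ℓ : ℝ) / 3 * ρ ≤ R := by
    rw [hρdef, hγRdef, hRdef, hLdef]; exact ell_rho_le_R ℓ t hℓ1 ht h4896
  have hℓρ0 : 0 ≤ (ℓ : ℝ) / 3 * ρ := by positivity
  have hpow : ((ℓ : ℝ) / 3) ^ (2 * k) * ρ ^ (2 * k) ≤ R ^ (2 * k) := by
    rw [← mul_pow]; exact pow_le_pow_left₀ hℓρ0 hℓρ _
  -- the junk term: `(ℓ/3)^{2k}·4N²L^{2k}/L^{10(t₀+1)+2} ≤ 4N²L^{4k}/L^{…} ≤ 1`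
  have hN0 : (0 : ℝ) ≤ N := Nat.cast_nonneg _
  have hb' : (N : ℝ) ≤ 2 ^ b := by rw [hNreal]; exact hb
  have hjunk := four_N_sq_pow_mul_inv_le_one hL2 hN0 hb' hkb
  have hℓ3L : (ℓ : ℝ) / 3 ≤ L := by
    have h1 : (ℓ : ℝ) ≤ L := by
      have hs1 : (1 : ℝ) ≤ ((2 * t : ℕ) : ℝ) := by exact_mod_cast (by omega : 1 ≤ 2 * t)
      have hℓ0 : (0 : ℝ) ≤ ℓ := Nat.cast_nonneg _
      have : (ℓ : ℝ) ≤ 4896 * (ℓ : ℝ) * (2 * t : ℕ) := by nlinarith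
      rw [hLdef]; linarith
    have h2 : (ℓ : ℝ) / 3 ≤ ℓ := by rw [div_le_iff₀ (by norm_num : (0:ℝ) < 3)]; linarith
    linarith
  have hjunk' : ((ℓ : ℝ) / 3) ^ (2 * k) * (4 * (N : ℝ) ^ 2 * L ^ (2 * k) * (L ^ (10 * (t₀ + 1) + 2))⁻¹) ≤ 1 := by
    have h1 : ((ℓ : ℝ) / 3) ^ (2 * k) ≤ L ^ (2 * k) := pow_le_pow_left₀ (by positivity) hℓ3L _
    have h2 : 0 ≤ 4 * (N : ℝ) ^ 2 * L ^ (2 * k) * (L ^ (10 * (t₀ + 1) + 2))⁻¹ := by positivity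
    calc ((ℓ : ℝ) / 3) ^ (2 * k) * (4 * (N : ℝ) ^ 2 * L ^ (2 * k) * (L ^ (10 * (t₀ + 1) + 2))⁻¹)
        ≤ L ^ (2 * k) * (4 * (N : ℝ) ^ 2 * L ^ (2 * k) * (L ^ (10 * (t₀ + 1) + 2))⁻¹) :=
          mul_le_mul_of_nonneg_right h1 h2
      _ = 4 * (N : ℝ) ^ 2 * L ^ (2 * (2 * k)) * (L ^ (10 * (t₀ + 1) + 2))⁻¹ := by
          rw [show 2 * (2 * k) = 2 * k + 2 * k by ring, pow_add]; ring
      _ ≤ 1 := hjunk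
  -- `20N ≤ 2^k`
  have hk' : 20 * (N : ℝ) ≤ 2 ^ k := by rw [hNreal]; exact hk
  have h20 := twenty_N_pow_le hR0 hk'
  have hR1 : (1 : ℝ) ≤ R := by
    rw [hRdef]
    have hℓ' : (1 : ℝ) ≤ (ℓ : ℝ) ^ 2 := one_le_pow₀ (by exact_mod_cast hℓ1)
    have hs1 : (1 : ℝ) ≤ ((2 * t : ℕ) : ℝ) := by exact_mod_cast (by omega : 1 ≤ 2 * t)
    have hs2 : (1 : ℝ) ≤ ((2 * t : ℕ) : ℝ) + 1 := by linarith
    have h2t : (1 : ℝ) ≤ (2 : ℝ) ^ t := one_le_pow₀ (by norm_num)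
    have a1 : (1 : ℝ) ≤ 2400 * (ℓ : ℝ) ^ 2 := one_le_mul_of_one_le_of_one_le (by norm_num) hℓ'
    have a2 := one_le_mul_of_one_le_of_one_le a1 hs1
    have a3 := one_le_mul_of_one_le_of_one_le a2 hs2
    exact one_le_mul_of_one_le_of_one_le a3 h2t
  -- rewrite the goal in terms of the abbreviations
  rw [← hNreal, ← hRdef]
  refine ⟨?_, ?_, ?_⟩
  · have hN1' : (1 : ℝ) ≤ N := by exact_mod_cast (hNdef ▸ hN1)
    have hNρ : 1 ≤ (N : ℝ) * R ^ (2 * k) :=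
      one_le_mul_of_one_le_of_one_le hN1' (one_le_pow₀ hR1)
    linarith
  · refine h7.trans ?_
    rw [← hNreal]
    have h2m : (0 : ℝ) ≤ 2 ^ m := pow_nonneg (by norm_num) m
    have e1 : ((ℓ : ℝ) / 3) ^ (2 * k) * (2 ^ m * ((N : ℝ) * ρ ^ (2 * k))
          + 2 ^ m * (4 * (N : ℝ) ^ 2 * L ^ (2 * k) * (L ^ (10 * (t₀ + 1) + 2))⁻¹))
        = 2 ^ m * ((N : ℝ) * (((ℓ : ℝ) / 3) ^ (2 * k) * ρ ^ (2 * k)))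
          + 2 ^ m * (((ℓ : ℝ) / 3) ^ (2 * k) * (4 * (N : ℝ) ^ 2 * L ^ (2 * k) * (L ^ (10 * (t₀ + 1) + 2))⁻¹)) := by
      ring
    rw [e1]
    have hA : 2 ^ m * ((N : ℝ) * (((ℓ : ℝ) / 3) ^ (2 * k) * ρ ^ (2 * k))) ≤ 2 ^ m * ((N : ℝ) * R ^ (2 * k)) :=
      mul_le_mul_of_nonneg_left (mul_le_mul_of_nonneg_left hpow hN0) h2m
    have hB : 2 ^ m * (((ℓ : ℝ) / 3) ^ (2 * k) * (4 * (N : ℝ) ^ 2 * L ^ (2 * k) * (L ^ (10 * (t₀ + 1) + 2))⁻¹))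
        ≤ 2 ^ m * 1 := mul_le_mul_of_nonneg_left hjunk' h2m
    have e2 : (2 : ℝ) ^ m * (10 * ((N : ℝ) * R ^ (2 * k) + 1) / 10)
        = 2 ^ m * ((N : ℝ) * R ^ (2 * k)) + 2 ^ m * 1 := by ring
    rw [e2]
    linarith
  · have hm' : 48 * R * n ≤ m := by
      rw [hRdef]; exact_mod_cast hm
    have h12 : 12 * (ℓ : ℝ) * R ≤ L := by rw [hRdef, hLdef]; exact twelve_ell_R_le ℓ t hT1
    have hN' : (N : ℝ) ≤ 8 * n + 2 * ℓ * m / L := by rw [hNreal, hLdef]; exact hN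
    exact remainder_budget_le_ell hL0 (Nat.cast_nonneg ℓ) hR0 hm' h12 hN'

end Summit.PneNP.PneNP.Theorems.Sd2Bl
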